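import Summits.HodgeConjecture.HodgeConjecture.Theorems.K2LiuSiegelEisensteinMajorantLocallyBounded   -- ★ p06: (H) discharged mod {E5′, (C0)}
import Summits.HodgeConjecture.HodgeConjecture.Theorems.K2LiuConstantTermBigCellUnfold              -- ★ p07: (H) ⇒ Integrable (w_Δ-cell)
import Summits.HodgeConjecture.HodgeConjecture.Theorems.K2LiuWeylDeltaRational                      -- ★ p06: w_Δ ∈ H(L⁺)
import Summits.HodgeConjecture.HodgeConjecture.Theorems.K2LiuIwasawaDatumNonempty                   -- ★ p09: Iwasawa datum
import Summits.HodgeConjecture.HodgeConjecture.Theorems.K2LiuSiegelDoubledParabolicReduction          -- ★ p09: E5 ⟸ E5′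
import Summits.HodgeConjecture.HodgeConjecture.Theorems.K2LiuSiegelDeltaHeightExists                -- ★ p07: continuous height Φ
import Mathlib.MeasureTheory.Measure.Haar.Basic
import HarnessLib

/-!
# O41.3 «the Siegel intertwining integral converges on `Re s > n/2`» — closed MODULO Godement's parabolic integral (E5′) and the
# cocompactness of `N_Δ(L⁺)` in `N_Δ(𝔸)` (C0)

Track B ∕ hLiu418 = stmt-HodgeConjecture-24832, line `K2_Liu_CurveThetaSigs`, unit U7 «CONTINUATION ORGANS of #41», socket O41.3
`sig_K2LiuIntertwiningConverges` (`Cruxes/HLiu418/Lines/K2_Liu_CurveThetaSigs_U7_ContinuationOrgans.lean` ED. 1 :57; bytes = K2Liu-p06's REPORT-FIRST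
(ii) 24484300a8e52eaa), LEAD F0P6-plan deal 2026-09-03T23:05:23Z to seat `hodgecm-mathlib-K2Liu-p06` (g0); FILE (iii-e) = the ASSEMBLY.

`integrable_weylDelta_mul_of_parabolic_of_cover` proves the socket's conclusion
`Integrable (fun u : N_Δ(𝔸) => f (w_Δ · u · h)) νN` for every unitary `χ`, `Re s > n/2`, continuous Siegel section `f ∈ I_Δ(s, χ)`, Haar `νN` and
`h ∈ H(𝔸)`, from exactly TWO named inputs carried as hypotheses (no other gap):
* (E5′) Godement's PARABOLIC INTEGRAL on `P_Δ(𝔸)` — K2Liu-p09's one remaining stub of socket #9 (`stub_E5'_parabolicIntegral`, same bytes);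
* (C0) a compact `K ⊆ N_Δ(𝔸)` meeting every `N_Δ(L⁺)`-orbit (`N_Δ(L⁺)\N_Δ(𝔸)` compact; organ E5′c, first half).
Road (the printed one, [MoeglinWaldspurger1995, II.1.6 Prop. (i)]): Haar `μ` on `H(𝔸)`, ★ Iwasawa datum (p855101), ★ continuous height `Φ`
(p854993), ★ `P_Δ(L⁺)`-weight, (E5′) ⇒ E5 (★ `lintegral_siegelDomain_ne_top_of_parabolic`) ⇒ the binder (H) «the Eisenstein majorant is integrable
over one compactly supported weighted fundamental domain of `N_Δ(L⁺)\N_Δ(𝔸)`» (★ `exists_weight_lintegral_majorant_ne_top`, p855574, using (C0))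
⇒ integrability of the `w_Δ`-cell (★ K2Liu-p07 `integrable_weylDelta_mul_of_lintegral_ne_top`, p855584, whose rational presentation binder `wq` is
supplied by ★ `weylDelta_mem_ratH`, p855590).  The corner `n = 0` (trivial group) is proved outright.

Theorems only; axioms ⊆ {propext, Classical.choice, Quot.sound}.

## References
* C. Moeglin, J.-L. Waldspurger, *Spectral decomposition and Eisenstein series* (1995), II.1.5–II.1.7 [MoeglinWaldspurger1995].
* S. Gelbart, I. Piatetski-Shapiro, S. Rallis, LNM 1254 (1987), Part A §§1–2, §5 [GelbartPiatetskishapiroRallis1987].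

HONEST LABEL: HC_CM is proved only modulo the 7 printed citations (2 remaining named inputs: hLiu418 = stmt-HodgeConjecture-24832,
h413 = stmt-HodgeConjecture-24833) until rung 0 closes; this helper moves no counter and closes O41.3 only modulo (E5′) and (C0).
-/

set_option autoImplicit false
set_option linter.dupNamespace false

noncomputable section

open scoped Matrix ENNReal NNReal
open NumberField IsDedekindDomain MeasureTheory

namespace Summit.HodgeConjecture.HodgeConjecture.Cruxes.HLiu418.K2LiuIntertwiningConvergesOfParabolic

open Literature.NumberTheory.Automorphic Literature.NumberTheory.GaloisRepresentations
open Literature.NumberTheory.GelbartRogawski1991 Literature.NumberTheory.GelbartRogawski1991.GRConstruction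
open Literature.NumberTheory.K2Lit.SiegelDoubled
open Literature.MeasureTheory.Group
open Summit.HodgeConjecture.HodgeConjecture.Cruxes.HLiu418.K2LiuSiegelEisensteinDoubledSummableReduction
open Summit.HodgeConjecture.HodgeConjecture.Cruxes.HLiu418.K2LiuIwasawaDatumNonempty
open Summit.HodgeConjecture.HodgeConjecture.Cruxes.HLiu418.K2LiuSiegelDoubledHeightSmear
open Summit.HodgeConjecture.HodgeConjecture.Cruxes.HLiu418.K2LiuSiegelDoubledUnfold
open Summit.HodgeConjecture.HodgeConjecture.Cruxes.HLiu418.K2LiuSiegelDoubledParabolicReduction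
open Summit.HodgeConjecture.HodgeConjecture.Cruxes.HLiu418.K2LiuSiegelDeltaHeightExists
open Summit.HodgeConjecture.HodgeConjecture.Cruxes.HLiu418.K2LiuSiegelEisensteinMajorantLocallyBounded
open Summit.HodgeConjecture.HodgeConjecture.Cruxes.HLiu418.K2LiuConstantTermBigCellUnfold
open Summit.HodgeConjecture.HodgeConjecture.Cruxes.HLiu418.K2LiuWeylDeltaRational

variable (L : Type) [Field L] [NumberField L] [IsCMField L]
variable {N M n : ℕ} (e : Fin N × Fin M ≃ Fin n)
  (dV : Fin N → L) (hdV : ∀ i, IsCMField.complexConj L (dV i) = dV i)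
  (dW : Fin M → L) (hdW : ∀ i, IsCMField.complexConj L (dW i) = dW i)

/-- **The rational presentation of the `w_Δ`-orbit**: `ν ↦ w_Δ · ν ∈ H(L⁺)` for `ν ∈ N_Δ(L⁺)` (★ `weylDelta_mem_ratH`) — the binder `wq` of
★ `K2LiuConstantTermBigCellUnfold`. [cite: GelbartPiatetskishapiroRallis1987, Part A §1] -/
theorem exists_wq : ∃ wq : unipDeltaRat L e dV hdV dW hdW → ratH L e dV hdV dW hdW,
    ∀ ν, ((wq ν : ratH L e dV hdV dW hdW) : HA L e dV hdV dW hdW) =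
      weylDelta L e dV hdV dW hdW * ((ν : unipDelta L e dV hdV dW hdW) : HA L e dV hdV dW hdW) :=
  ⟨fun ν => ⟨weylDelta L e dV hdV dW hdW * ((ν : unipDelta L e dV hdV dW hdW) : HA L e dV hdV dW hdW),
      mul_mem (weylDelta_mem_ratH L e dV hdV dW hdW) ((mem_unipDeltaRat_iff L e dV hdV dW hdW ν).1 ν.2)⟩,
    fun _ => rfl⟩

/-- the doubled group is trivial when `n = 0` (no `0 × 0` matrices): `H(𝔸)` is a subsingleton. [folklore] -/
theorem subsingleton_HA_of_eq_zero (hn : n = 0) : Subsingleton (HA L e dV hdV dW hdW) := by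
  subst hn
  haveI : IsEmpty (Fin (0 + 0)) := ⟨fun i => Nat.not_lt_zero _ i.2⟩
  haveI : Subsingleton (GL (Fin (0 + 0)) (AdeleRing (𝓞 L) L)) := ⟨fun a b => Units.ext (Subsingleton.elim _ _)⟩
  infer_instance

/-- **O41.3 CLOSED MODULO (E5′) AND (C0).**  For a unitary `χ`, `Re s > n/2`, a continuous Siegel section `f ∈ I_Δ(s, χ)`, a Haar measure `νN` on
`N_Δ(𝔸)` and `h ∈ H(𝔸)`: GIVEN Godement's parabolic integral (E5′, K2Liu-p09's stub of socket #9, verbatim) and a compact set meeting every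
`N_Δ(L⁺)`-orbit in `N_Δ(𝔸)` (C0), the Siegel intertwining integrand `u ↦ f(w_Δ u h)` is `νN`-integrable — the conclusion of socket
`sig_K2LiuIntertwiningConverges` at `h`. [cite: MoeglinWaldspurger1995, II.1.6 (Prop. (i) and its proof)] [cite: GelbartPiatetskishapiroRallis1987, Part A §5] -/
theorem integrable_weylDelta_mul_of_parabolic_of_cover (hdV0 : ∀ i, dV i ≠ 0) (hdW0 : ∀ i, dW i ≠ 0)
    {χ : HeckeCharacter L} (hχ : χ.IsUnitary) {s : ℂ} (hs : (n : ℝ) / 2 < s.re)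
    {f : HA L e dV hdV dW hdW → ℂ} (hf : IsSiegelDeltaSection L e dV hdV dW hdW χ s f) (hfc : Continuous f)
    [MeasurableSpace (unipDelta L e dV hdV dW hdW)] [BorelSpace (unipDelta L e dV hdV dW hdW)]
    (νN : Measure (unipDelta L e dV hdV dW hdW)) [νN.IsHaarMeasure]
    (hE5' : ∀ [MeasurableSpace (HA L e dV hdV dW hdW)] [BorelSpace (HA L e dV hdV dW hdW)] (τ : ℝ), 2 * (n : ℝ) < τ →
      ∃ (μP : Measure (siegelDelta L e dV hdV dW hdW : Subgroup (HA L e dV hdV dW hdW))) (_ : μP.IsHaarMeasure)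
        (w₁ : ↥(siegelDelta L e dV hdV dW hdW) → ℝ≥0∞),
        IsCoveringWeight (↥((ratH L e dV hdV dW hdW).subgroupOf (siegelDelta L e dV hdV dW hdW))) w₁ ∧
        ∀ C₁ : ℝ, ∫⁻ p, {p : ↥(siegelDelta L e dV hdV dW hdW) |
            modDelta L e dV hdV dW hdW (p : HA L e dV hdV dW hdW) ≤ C₁}.indicator
              (fun p => ENNReal.ofReal (modDelta L e dV hdV dW hdW (p : HA L e dV hdV dW hdW) ^ τ)) p * w₁ p ∂μP ≠ ∞)
    {K : Set (unipDelta L e dV hdV dW hdW)} (hK : IsCompact K)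
    (hcover : ∀ u : unipDelta L e dV hdV dW hdW, ∃ γ : unipDeltaRat L e dV hdV dW hdW, γ • u ∈ K)
    (h : HA L e dV hdV dW hdW) :
    Integrable (fun u : unipDelta L e dV hdV dW hdW =>
      f (weylDelta L e dV hdV dW hdW * (u : HA L e dV hdV dW hdW) * h)) νN := by
  rcases Nat.eq_zero_or_pos n with hn | hn
  · -- `n = 0`: `N_Δ(𝔸)` is a point
    haveI : Subsingleton (HA L e dV hdV dW hdW) := subsingleton_HA_of_eq_zero L e dV hdV dW hdW hn
    haveI : Finite (unipDelta L e dV hdV dW hdW) := Finite.of_subsingleton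
    exact Integrable.of_finite
  -- Borel structure and a Haar measure on `H(𝔸)`
  letI : MeasurableSpace (HA L e dV hdV dW hdW) := borel _
  haveI : BorelSpace (HA L e dV hdV dW hdW) := ⟨rfl⟩
  let μ : Measure (HA L e dV hdV dW hdW) := Measure.haar
  -- the Iwasawa datum and the continuous height of record
  obtain ⟨𝒦⟩ := iwasawaDatumNonempty L e dV hdV hdV0 dW hdW hdW0
  obtain ⟨Φ, hΦc, hΦpos, hΦ, hΦK, hΦfloor⟩ := exists_siegelHeight_continuous L e dV hdV dW hdW hdV0 hdW0
  have hΦm : Measurable Φ := hΦc.measurable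
  have hτ : 2 * (n : ℝ) < 2 * s.re + (n : ℝ) := two_mul_lt_two_mul_re_add hs
  have hτ0 : 0 ≤ 2 * s.re + (n : ℝ) := (two_mul_re_add_pos (n := n) hs).le
  -- Godement: (E5′) ⇒ E5
  obtain ⟨β', hβ'⟩ := exists_isCoveringWeight_siegelDeltaRat L e dV hdV dW hdW
  obtain ⟨μP, hμP, w₁, hw₁, hE5P⟩ := hE5' _ hτ
  have hE5 := lintegral_siegelDomain_ne_top_of_parabolic L e dV hdV dW hdW μ 𝒦 hΦm hΦpos hΦ hΦK
    (upper_bound_of_floor L e dV hdV dW hdW hΦfloor) hτ0 μP hw₁ hE5P hβ'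
  -- the binder (H) over a compactly supported `N_Δ(L⁺)`-weight (uses (C0))
  obtain ⟨β, hβ, -, -, hH⟩ := exists_weight_lintegral_majorant_ne_top L e dV hdV dW hdW μ hχ hτ0 hf hfc 𝒦.isCompact_K 𝒦.iwasawa
    hΦm hΦpos hΦ hΦK hΦfloor hβ' hE5 νN hK hcover h
  -- the `w_Δ`-cell is integrable
  obtain ⟨wq, hwq⟩ := exists_wq L e dV hdV dW hdW
  have hH' : ∫⁻ u, (∑' q : SiegelDeltaQuot L e dV hdV dW hdW,
      ‖f ((((Quotient.out q : ratH L e dV hdV dW hdW) : HA L e dV hdV dW hdW)) * (((u : unipDelta L e dV hdV dW hdW) : HA L e dV hdV dW hdW) * h))‖ₑ) *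
        β u ∂νN ≠ ∞ := by
    simpa only [mul_assoc] using hH
  exact integrable_weylDelta_mul_of_lintegral_ne_top wq hwq hn νN hβ hf hfc h hH'

end Summit.HodgeConjecture.HodgeConjecture.Cruxes.HLiu418.K2LiuIntertwiningConvergesOfParabolic

end
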